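import Mathlib
import HarnessLib

/-!
# The multiplicative grid and the cell decomposition of the bulk (helper toward
`stub_poissonReduction`, line `cofactor-root-discrepancy`, crux `SplitBlockJacobi`,
stmt-Parity-11583)

The bulk pairs `(Q, Q′)`, `QQ′ ≤ X`, are sorted into the cells of the grid
`g_i = ⌊y₀ r^i⌋` (`r = 1 + 1/T`): monotonicity, the dyadic property `g_{i+1} ≤ 2 g_i`, the
location of cell members (`y₀ rⁱ < Q ≤ y₀ r^{i+1}`), coverage (`g_0 < Q ≤ g_I` lies in some cell,
and `(1 + 1/T)^{Tj} ≥ 2^j` makes `I = T·j` cells reach any prescribed height), the SHELL property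
of bad cells (`g_{i+1} g_{j+1} > X` forces `QQ′ > X(1 − 2/T)`), the generic decomposition
`Σ_B F = Σ_{good cells} Σ_{cell ∩ B} F + Σ_{rest} F` with the rest lying in bad cells, and the
symmetrisation of a diagonal cell (`Σ_{Q<Q′} F = ½ Σ_{Q≠Q′} F` for symmetric `F`).
-/

noncomputable section

open Finset

namespace Summit.Parity.BatemanHorn.Cruxes.SplitBlockJacobi.CofactorRootDiscrepancy.Poisson

/-! ### The grid `g_i = ⌊y₀ rⁱ⌋` -/

/-- The grid is monotone. -/
theorem grid_mono {y₀ r : ℝ} (hy : 0 ≤ y₀) (hr : 1 ≤ r) :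
    Monotone (fun i : ℕ => ⌊y₀ * r ^ i⌋₊) := by
  intro i j hij
  exact Nat.floor_le_floor (mul_le_mul_of_nonneg_left (pow_le_pow_right₀ hr hij) hy)

/-- Members of the cell `(g_i, g_{i+1}]` satisfy `y₀ rⁱ < Q ≤ y₀ r^{i+1}`. -/
theorem bounds_of_mem_cell {y₀ r : ℝ} (hy : 0 ≤ y₀) (hr : 0 ≤ r) {i Q : ℕ}
    (hQ : Q ∈ Finset.Ioc ⌊y₀ * r ^ i⌋₊ ⌊y₀ * r ^ (i + 1)⌋₊) :
    y₀ * r ^ i < Q ∧ (Q : ℝ) ≤ y₀ * r ^ (i + 1) := by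
  rw [Finset.mem_Ioc] at hQ
  refine ⟨(Nat.floor_lt (by positivity)).mp hQ.1, ?_⟩
  have h := hQ.2
  have hQ1 : 1 ≤ Q := by omega
  exact (Nat.le_floor_iff (by positivity)).mp h

/-- The dyadic property `g_{i+1} ≤ 2 g_i` (`y₀ ≥ 3`, `T ≥ 2`, `r = 1 + 1/T`). -/
theorem grid_succ_le_two_mul {y₀ : ℝ} (hy : 3 ≤ y₀) {T : ℕ} (hT : 2 ≤ T) (i : ℕ) :
    ⌊y₀ * (1 + 1 / (T : ℝ)) ^ (i + 1)⌋₊ ≤ 2 * ⌊y₀ * (1 + 1 / (T : ℝ)) ^ i⌋₊ := by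
  set r : ℝ := 1 + 1 / (T : ℝ) with hr
  have hT0 : (0 : ℝ) < T := by exact_mod_cast (show 0 < T by omega)
  have hr1 : 1 ≤ r := by rw [hr]; exact le_add_of_nonneg_right (by positivity)
  have hr32 : r ≤ 3 / 2 := by
    rw [hr]
    have : 1 / (T : ℝ) ≤ 1 / 2 := by
      rw [div_le_div_iff₀ hT0 two_pos]; norm_cast; omega
    linarith
  have hgi : y₀ * r ^ i - 1 < ⌊y₀ * r ^ i⌋₊ := by
    have := Nat.lt_floor_add_one (y₀ * r ^ i); linarith
  have hpow : 1 ≤ r ^ i := one_le_pow₀ hr1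
  have hy3 : 3 ≤ y₀ * r ^ i := by nlinarith
  refine Nat.le_of_lt_succ ((Nat.floor_lt (by positivity)).mpr ?_)
  push_cast
  calc y₀ * r ^ (i + 1) = r * (y₀ * r ^ i) := by ring
    _ ≤ 3 / 2 * (y₀ * r ^ i) := mul_le_mul_of_nonneg_right hr32 (by positivity)
    _ < 2 * ((⌊y₀ * r ^ i⌋₊ : ℕ) : ℝ) + 1 := by nlinarith

/-- `(1 + 1/T)^{T j} ≥ 2^j` (Bernoulli). -/
theorem two_pow_le_pow_mul (T j : ℕ) (hT : 1 ≤ T) :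
    (2 : ℝ) ^ j ≤ (1 + 1 / (T : ℝ)) ^ (T * j) := by
  rw [pow_mul]
  refine pow_le_pow_left₀ (by norm_num) ?_ j
  have h := one_add_mul_le_pow (a := 1 / (T : ℝ))
    (by have : (0 : ℝ) ≤ 1 / (T : ℝ) := by positivity
        linarith) T
  have hT0 : (T : ℝ) ≠ 0 := by exact_mod_cast (show T ≠ 0 by omega)
  rw [mul_one_div_cancel hT0] at h
  linarith

/-- Coverage: if `g` is monotone and `g 0 < Q ≤ g I` then `Q` lies in some cell `(g i, g (i+1)]`,
`i < I`. -/
theorem exists_cell_of_mem {g : ℕ → ℕ} (I Q : ℕ) (h0 : g 0 < Q) (hI : Q ≤ g I) :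
    ∃ i, i < I ∧ Q ∈ Finset.Ioc (g i) (g (i + 1)) := by
  induction I with
  | zero => omega
  | succ I ih =>
    by_cases h : Q ≤ g I
    · obtain ⟨i, hi, hmem⟩ := ih h
      exact ⟨i, by omega, hmem⟩
    · push Not at h
      exact ⟨I, by omega, Finset.mem_Ioc.mpr ⟨h, hI⟩⟩

/-- **The shell property of a bad cell**: if `Q ∈ (g_i, g_{i+1}]`, `Q′ ∈ (g_j, g_{j+1}]` and
`g_{i+1} g_{j+1} > X ≥ 0`, then `QQ′ > X (1 − 2/T)` (`T ≥ 2`). -/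
theorem shell_of_bad_cell {y₀ X : ℝ} (hy : 0 ≤ y₀) (hX : 0 ≤ X) {T : ℕ} (hT : 2 ≤ T) {i j Q Q' : ℕ}
    (hQ : Q ∈ Finset.Ioc ⌊y₀ * (1 + 1 / (T : ℝ)) ^ i⌋₊ ⌊y₀ * (1 + 1 / (T : ℝ)) ^ (i + 1)⌋₊)
    (hQ' : Q' ∈ Finset.Ioc ⌊y₀ * (1 + 1 / (T : ℝ)) ^ j⌋₊ ⌊y₀ * (1 + 1 / (T : ℝ)) ^ (j + 1)⌋₊)
    (hbad : X < ((⌊y₀ * (1 + 1 / (T : ℝ)) ^ (i + 1)⌋₊ * ⌊y₀ * (1 + 1 / (T : ℝ)) ^ (j + 1)⌋₊ : ℕ) : ℝ)) :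
    X * (1 - 2 / (T : ℝ)) < ((Q * Q' : ℕ) : ℝ) := by
  set r : ℝ := 1 + 1 / (T : ℝ) with hr
  have hT0 : (0 : ℝ) < T := by exact_mod_cast (show 0 < T by omega)
  have hT2 : (2 : ℝ) ≤ T := by exact_mod_cast hT
  have hr0 : 0 < r := by rw [hr]; positivity
  obtain ⟨hQl, -⟩ := bounds_of_mem_cell hy hr0.le hQ
  obtain ⟨hQ'l, -⟩ := bounds_of_mem_cell hy hr0.le hQ'
  have hg1 : ((⌊y₀ * r ^ (i + 1)⌋₊ : ℕ) : ℝ) ≤ y₀ * r ^ (i + 1) := Nat.floor_le (by positivity)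
  have hg2 : ((⌊y₀ * r ^ (j + 1)⌋₊ : ℕ) : ℝ) ≤ y₀ * r ^ (j + 1) := Nat.floor_le (by positivity)
  push_cast at hbad ⊢
  -- `QQ′ > y₀² r^{i+j} = (y₀ r^{i+1})(y₀ r^{j+1}) / r² ≥ g_{i+1} g_{j+1} / r² > X / r²`
  have hprod : y₀ * r ^ i * (y₀ * r ^ j) < (Q : ℝ) * Q' :=
    mul_lt_mul'' hQl hQ'l (by positivity) (by positivity)
  have hXr : X < y₀ * r ^ (i + 1) * (y₀ * r ^ (j + 1)) :=
    hbad.trans_le (mul_le_mul hg1 hg2 (Nat.cast_nonneg _) (by positivity))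
  have hkey : y₀ * r ^ (i + 1) * (y₀ * r ^ (j + 1)) = r ^ 2 * (y₀ * r ^ i * (y₀ * r ^ j)) := by ring
  rw [hkey] at hXr
  -- `1 - 2/T ≤ 1/r²`
  have hr2 : 1 - 2 / (T : ℝ) ≤ 1 / r ^ 2 := by
    rw [hr, le_div_iff₀ (by positivity)]
    field_simp
    nlinarith
  calc X * (1 - 2 / (T : ℝ)) ≤ X * (1 / r ^ 2) := mul_le_mul_of_nonneg_left hr2 hX
    _ = X / r ^ 2 := by ring
    _ < y₀ * r ^ i * (y₀ * r ^ j) := by rw [div_lt_iff₀ (by positivity)]; linarith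
    _ < (Q : ℝ) * Q' := hprod

/-! ### Cells of a monotone grid are disjoint; the decomposition -/

/-- A point lies in at most one cell of a monotone grid. -/
theorem cell_index_unique {g : ℕ → ℕ} (hg : Monotone g) {i i' Q : ℕ}
    (h1 : Q ∈ Finset.Ioc (g i) (g (i + 1))) (h2 : Q ∈ Finset.Ioc (g i') (g (i' + 1))) : i = i' := by
  rw [Finset.mem_Ioc] at h1 h2
  by_contra hne
  rcases Nat.lt_or_gt_of_ne hne with h | h
  · have := hg (show i + 1 ≤ i' by omega); omega
  · have := hg (show i' + 1 ≤ i by omega); omega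

/-- The cells `{q ∈ B : q.1 ∈ (g_i, g_{i+1}], q.2 ∈ (g_j, g_{j+1}]}` are pairwise disjoint. -/
theorem pairwiseDisjoint_cells {g : ℕ → ℕ} (hg : Monotone g) (B : Finset (ℕ × ℕ))
    (S : Finset (ℕ × ℕ)) :
    (S : Set (ℕ × ℕ)).PairwiseDisjoint (fun ij : ℕ × ℕ => B.filter (fun q : ℕ × ℕ =>
      q.1 ∈ Finset.Ioc (g ij.1) (g (ij.1 + 1)) ∧ q.2 ∈ Finset.Ioc (g ij.2) (g (ij.2 + 1)))) := by
  intro ij _ ij' _ hne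
  simp only [Function.onFun]
  rw [Finset.disjoint_filter]
  intro q _ h h'
  apply hne
  exact Prod.ext (cell_index_unique hg h.1 h'.1) (cell_index_unique hg h.2 h'.2)

/-- **Decomposition**: for any finite `B ⊆ ℕ²`, monotone grid `g` and index set `S`,
`Σ_B F = Σ_{ij ∈ S} Σ_{B ∩ cell ij} F + Σ_{B ∖ ⋃_{ij ∈ S} (B ∩ cell ij)} F`. -/
theorem sum_eq_sum_cells_add_sum_sdiff (B : Finset (ℕ × ℕ)) {g : ℕ → ℕ} (hg : Monotone g)
    (S : Finset (ℕ × ℕ)) (F : ℕ × ℕ → ℝ) :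
    ∑ q ∈ B, F q =
      ∑ ij ∈ S, ∑ q ∈ B.filter (fun q : ℕ × ℕ =>
          q.1 ∈ Finset.Ioc (g ij.1) (g (ij.1 + 1)) ∧ q.2 ∈ Finset.Ioc (g ij.2) (g (ij.2 + 1))), F q +
      ∑ q ∈ B \ S.biUnion (fun ij : ℕ × ℕ => B.filter (fun q : ℕ × ℕ =>
          q.1 ∈ Finset.Ioc (g ij.1) (g (ij.1 + 1)) ∧ q.2 ∈ Finset.Ioc (g ij.2) (g (ij.2 + 1)))), F q := by
  have hU : S.biUnion (fun ij : ℕ × ℕ => B.filter (fun q : ℕ × ℕ =>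
      q.1 ∈ Finset.Ioc (g ij.1) (g (ij.1 + 1)) ∧ q.2 ∈ Finset.Ioc (g ij.2) (g (ij.2 + 1)))) ⊆ B := by
    intro q hq
    rw [Finset.mem_biUnion] at hq
    obtain ⟨ij, -, h⟩ := hq
    exact (Finset.mem_filter.mp h).1
  rw [← Finset.sum_biUnion (pairwiseDisjoint_cells hg B S), add_comm, Finset.sum_sdiff hU]

/-- Membership in the remainder: not in any cell indexed by `S`. -/
theorem not_mem_cell_of_mem_sdiff {B : Finset (ℕ × ℕ)} {g : ℕ → ℕ} {S : Finset (ℕ × ℕ)}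
    {q : ℕ × ℕ}
    (hq : q ∈ B \ S.biUnion (fun ij : ℕ × ℕ => B.filter (fun q : ℕ × ℕ =>
      q.1 ∈ Finset.Ioc (g ij.1) (g (ij.1 + 1)) ∧ q.2 ∈ Finset.Ioc (g ij.2) (g (ij.2 + 1))))) :
    q ∈ B ∧ ∀ ij ∈ S, ¬ (q.1 ∈ Finset.Ioc (g ij.1) (g (ij.1 + 1)) ∧
      q.2 ∈ Finset.Ioc (g ij.2) (g (ij.2 + 1))) := by
  rw [Finset.mem_sdiff, Finset.mem_biUnion] at hq
  refine ⟨hq.1, fun ij hij h => hq.2 ⟨ij, hij, Finset.mem_filter.mpr ⟨hq.1, h⟩⟩⟩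

/-! ### Symmetrisation of a diagonal cell -/

/-- For `F` symmetric on `{C} × {C}` and vanishing on the diagonal:
`Σ_{Q<Q′, C Q, C Q′} F(Q,Q′) = ½ Σ_{C Q, C Q′} F(Q,Q′)` (both over `s × s`). -/
theorem sum_filter_lt_eq_half (s : Finset ℕ) (C : ℕ → Prop) [DecidablePred C] (F : ℕ × ℕ → ℝ)
    (hsymm : ∀ Q ∈ s, ∀ Q' ∈ s, C Q → C Q' → F (Q, Q') = F (Q', Q))
    (hdiag : ∀ Q ∈ s, C Q → F (Q, Q) = 0) :
    ∑ q ∈ (s ×ˢ s).filter (fun q : ℕ × ℕ => (C q.1 ∧ C q.2) ∧ q.1 < q.2), F q =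
      (1 / 2) * ∑ q ∈ (s ×ˢ s).filter (fun q : ℕ × ℕ => C q.1 ∧ C q.2), F q := by
  set A := (s ×ˢ s).filter (fun q : ℕ × ℕ => C q.1 ∧ C q.2) with hA
  have hsplit := Finset.sum_filter_add_sum_filter_not A (fun q : ℕ × ℕ => q.1 < q.2) F
  have hlt : (s ×ˢ s).filter (fun q : ℕ × ℕ => (C q.1 ∧ C q.2) ∧ q.1 < q.2) =
      A.filter (fun q : ℕ × ℕ => q.1 < q.2) := by
    rw [hA, Finset.filter_filter]
  rw [hlt]
  -- the complement splits into `Q′ < Q` and the diagonal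
  have hnot : ∑ q ∈ A.filter (fun q : ℕ × ℕ => ¬ q.1 < q.2), F q =
      ∑ q ∈ A.filter (fun q : ℕ × ℕ => q.2 < q.1), F q +
        ∑ q ∈ A.filter (fun q : ℕ × ℕ => q.1 = q.2), F q := by
    have e1 : (A.filter (fun q : ℕ × ℕ => ¬ q.1 < q.2)).filter (fun q : ℕ × ℕ => q.2 < q.1) =
        A.filter (fun q : ℕ × ℕ => q.2 < q.1) := by
      ext q
      simp only [Finset.mem_filter]
      constructor
      · rintro ⟨⟨h0, -⟩, h2⟩; exact ⟨h0, h2⟩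
      · rintro ⟨h0, h2⟩; exact ⟨⟨h0, by omega⟩, h2⟩
    have e2 : (A.filter (fun q : ℕ × ℕ => ¬ q.1 < q.2)).filter (fun q : ℕ × ℕ => ¬ q.2 < q.1) =
        A.filter (fun q : ℕ × ℕ => q.1 = q.2) := by
      ext q
      simp only [Finset.mem_filter]
      constructor
      · rintro ⟨⟨h0, h1⟩, h2⟩; exact ⟨h0, by omega⟩
      · rintro ⟨h0, h2⟩; exact ⟨⟨h0, by omega⟩, by omega⟩
    rw [← Finset.sum_filter_add_sum_filter_not (A.filter (fun q : ℕ × ℕ => ¬ q.1 < q.2))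
      (fun q : ℕ × ℕ => q.2 < q.1) F, e1, e2]
  have hdiag0 : ∑ q ∈ A.filter (fun q : ℕ × ℕ => q.1 = q.2), F q = 0 := by
    refine Finset.sum_eq_zero fun q hq => ?_
    rw [Finset.mem_filter, hA, Finset.mem_filter, Finset.mem_product] at hq
    obtain ⟨⟨⟨h1, -⟩, hC, -⟩, heq⟩ := hq
    have : q = (q.1, q.1) := by ext <;> simp [heq]
    rw [this]
    exact hdiag q.1 h1 hC
  have hswap : ∑ q ∈ A.filter (fun q : ℕ × ℕ => q.2 < q.1), F q =
      ∑ q ∈ A.filter (fun q : ℕ × ℕ => q.1 < q.2), F q := by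
    refine Finset.sum_equiv (Equiv.prodComm ℕ ℕ) (fun q => ?_) (fun q hq => ?_)
    · simp only [Equiv.prodComm_apply, Finset.mem_filter, hA, Finset.mem_product, Prod.fst_swap,
        Prod.snd_swap]
      tauto
    · rw [Finset.mem_filter, hA, Finset.mem_filter, Finset.mem_product] at hq
      simp only [Equiv.prodComm_apply]
      have := hsymm q.1 hq.1.1.1 q.2 hq.1.1.2 hq.1.2.1 hq.1.2.2
      rw [show q.swap = (q.2, q.1) from rfl, ← this]
  rw [← hsplit, hnot, hdiag0, hswap]
  ring

end Summit.Parity.BatemanHorn.Cruxes.SplitBlockJacobi.CofactorRootDiscrepancy.Poisson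

namespace Summit.Parity.BatemanHorn.Cruxes.SplitBlockJacobi.CofactorRootDiscrepancy

/-- **Registered stub form** of `Poisson.sum_eq_sum_cells_add_sum_sdiff`: the identical statement, declared in the crux
namespace under the name registered on stmt-Parity-11583 (`ledger workitem stub-add`). -/
theorem sum_eq_sum_cells_add_sum_sdiff :
    ∀ (B : Finset (ℕ × ℕ)) {g : ℕ → ℕ} (hg : Monotone g) (S : Finset (ℕ × ℕ)) (F : ℕ × ℕ → ℝ), ∑ q ∈ B, F q = ∑ ij ∈ S, ∑ q ∈ B.filter (fun q : ℕ × ℕ => q.1 ∈ Finset.Ioc (g ij.1) (g (ij.1 + 1)) ∧ q.2 ∈ Finset.Ioc (g ij.2) (g (ij.2 + 1))), F q + ∑ q ∈ B \ S.biUnion (fun ij : ℕ × ℕ => B.filter (fun q : ℕ × ℕ => q.1 ∈ Finset.Ioc (g ij.1) (g (ij.1 + 1)) ∧ q.2 ∈ Finset.Ioc (g ij.2) (g (ij.2 + 1)))), F q :=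
  @Poisson.sum_eq_sum_cells_add_sum_sdiff

end Summit.Parity.BatemanHorn.Cruxes.SplitBlockJacobi.CofactorRootDiscrepancy

end
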